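import Summits.BirchSwinnertonDyer.BirchSwinnertonDyer.Theorems.ByReductionTypeAtTwoOrdKatoHalfAtTwoIsoOptimalSplitDefs
import Literature.NumberTheory.EllipticCurves.SkinnerUrban2014.PAdicUnitPeriodRatioAnyPrimeProofs
import Literature.NumberTheory.EllipticCurves.CuspFormLFunctionLevelConductorProofs
import HarnessLib

/-!
# Route ByReductionTypeAtTwo, crux `OrdKatoHalfAtTwoIso` (stmt-BirchSwinnertonDyer-19573), line
# `steinberg-fibre-at-two`: child B7′ (stmt-BirchSwinnertonDyer-23921 `OrdKatoMuPartOptimalAtTwo` =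
# `KatoMuPartOff514AtOptimalMemberOfNotSurjectiveTwo`) — the MEMBER PINNED TO THE `X₀(N)`-OPTIMAL CURVE
# (kernel doors; theorems only)

Seat `cruxlead-stmt-BirchSwinnertonDyer-19573-w2` GEN 3 (prover WIDTH under LEAD cruxlead-19573 g5; HOME
`run/shared/lean/pub/bsd-2adic/`; `--supports` stmt-BirchSwinnertonDyer-23921; pen RC-386 (iii) «B7′ lane: doors BY
NAME onto `KatoMuPartOff514AtOptimalMemberOfNotSurjectiveTwo`»). HONEST FRAMING (cell bsd-2adic): BSD is not proved by
any of this; the crux `OrdKatoHalfAtTwoIso` and the child B7′ are NOT proved here; THEOREMS ONLY (no definition, no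
named fact, nothing asserted); every door is CONDITIONAL on the binders it displays.

WHY THIS FILE. B7′ asks, for every non-CM good-ordinary-at-`2` `W` with `ρ̄_{W,2}` not onto, for SOME isogenous
globally minimal member `W′` carrying (a′) «Kato's `μ`-part `X5.O1.KatoMuPartAtTwo W′` OR a Prop-5.14 point» AND
(b) «an integral Iwasawa lift `L₀ ∈ Λ` of `ϖ·L₂(f, α)` for every newform `f` of `W′` and every `ϖ` with
`ϖ·Ω_{W′} = Ω⁺_f`». The line's earlier doors make (b) PRINT only on `E[2]`-IRREDUCIBLE classes (Abbes–Ullmo +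
odd-degree isogenies: `hint_two_of_abbesUllmo_of_irr`, p654400) and leave it «beyond print» on the reducible part
(`KatoMuPartOff514ReducibleTwo`, p680193: «Manin constant / `c_∞` bookkeeping at the optimal member»). OBSERVATION
(this file): at a LATTICE-OPTIMAL member `W₀` — a globally minimal model of the strong Weil curve, i.e. a modular
parametrisation datum `D₀` with `Λ_{W₀} = c₀·Λ_f` (Edixhoven 1991 Prop. 2; tree theorem
`ModularParametrizationData.exists_optimalDatum_of_edixhoven` + `edixhoven_int_of_neronLattice_eq_smul_periodLattice_holds`)
— clause (b) is PRINT FOR EVERY IMAGE of `ρ̄_{W,2}`: `Ω_{W₀} = |c₀|·Ω⁺_f` exactly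
(`realPeriodRat_eq_abs_mul_plusPeriod_of_latticeEq`), `2 ∤ c₀` at the good prime `2` (Abbes–Ullmo 1996 Thm. A BY
NAME, `abbesUllmo_not_dvd_maninConstant_of_not_dvd_level`), so `ϖ = ±1/c₀` is a `2`-adic unit and INT2-AUTO
(`X5.O1.exists_integral_mul_padicLFunction_two_of_padicValRat_nonneg`) supplies `L₀`; every other newform of `W₀`
has the same level (strong multiplicity one across levels, `IsNewformOf.level_eq_level`, unconditional) and is
then the same form (`IsNewformOf.unique`). No `E[2]`-irreducibility, no parity, no `c_∞` enters.

CONSEQUENCE (doors, all KERNEL modulo the displayed print binders):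
* `hint_two_of_latticeOptimal_of_abbesUllmo` — clause (b) at any lattice-optimal good-ordinary-at-`2` member.
* `katoMuPartOff514Conclusion_of_latticeOptimal` — **B7′'s conclusion at `W` from its optimal member**: if an
  isogenous lattice-optimal `W₀` carries «`KatoMuPartAtTwo W₀` OR a Prop-5.14 point», the body of B7′ holds at `W`
  (witness `W′ := W₀`).
* `katoMuPartOff514Conclusion_of_latticeOptimal_prop514Point` — the PRINT-COMPLETE case: a ramified-XOR-odd rational
  `2`-torsion point ON THE OPTIMAL CURVE gives B7′ at `W` outright (modulo Abbes–Ullmo by name); this is the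
  per-class census door («does `E₀` carry the 5.14 point?»).
* `katoMuPartOff514_of_optimalMember` — **B7′ BY NAME ⟸ Abbes–Ullmo + modularity (`nonempty_modularParametrizationData`,
  the route's PUB first conjunct) + ONE member-free binder**: «for every non-CM good-ordinary-at-`2` `W` with `ρ̄_{W,2}`
  not onto and every isogenous lattice-optimal `W₀`: `KatoMuPartAtTwo W₀` OR a Prop-5.14 point on `W₀`». The `∃ W′`
  and clause (b) of B7′ are ELIMINATED; what is beyond print in B7′ is exactly Kato's `μ`-part AT THE OPTIMAL CURVE
  off the locus where the optimal curve carries the 5.14 point (Greenberg Conj. 1.11 at `2` there; nothing asserted).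
* `katoMuPartOff514Reducible_of_optimalMember` — the same onto the reducible part `KatoMuPartOff514ReducibleTwo`.

What this is NOT: not a proof of B7′ or of its parts; not a claim that the optimal curve is the `μ = 0` member
(Greenberg LNM 1716 p. 170: `μ_{E₀} > 0` happens, e.g. `N = 15`); no census number moves (kit 0 in this seat).

References: [AbbesUllmo1996] Thm. A; [EdixhovenManin1991] Prop. 2 and §1; [GreenbergLNM1716] Prop. 5.14, p. 170,
Conj. 1.11 (shape only); [AtkinLehner1970] Thm. 4; [MazurTateTeitelbaum1986Invent] §I.12; MEMO-7 (HOME).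
-/

set_option autoImplicit false
set_option linter.dupNamespace false

noncomputable section

open scoped Classical MatrixGroups ModularForm NumberField
open CongruenceSubgroup WeierstrassCurve Field IsDedekindDomain
open Literature.NumberTheory.GaloisRepresentations
open Literature.NumberTheory.EllipticCurves Literature.NumberTheory.EllipticCurves.ModularForms
open Literature.NumberTheory.EllipticCurves.Kato2004
open Literature.NumberTheory.EllipticCurves.Rank1Residual
open Literature.NumberTheory.EllipticCurves.Greenberg1999
open Literature.NumberTheory.EllipticCurves.SkinnerUrban2014
open Summit.BirchSwinnertonDyer.Rank1Residual Summit.BirchSwinnertonDyer.Rank1Residual.X5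
open Summit.BirchSwinnertonDyer.BirchSwinnertonDyer.Theorems.OrdKatoOptimalAtTwo
  Summit.BirchSwinnertonDyer.BirchSwinnertonDyer.Theorems.OrdKatoIntAtTwo
open Summit.BirchSwinnertonDyer.BirchSwinnertonDyer.Theses.ByReductionTypeAtTwo

namespace Summit.BirchSwinnertonDyer.BirchSwinnertonDyer.Theorems.SteinbergFibreAtTwo

/-! ## §1 Clause (b) of B7′ at a lattice-optimal member is PRINT (Abbes–Ullmo by name) -/

/-- For an integer `z` not divisible by the prime `p`, `‖z‖_p = 1`. [folklore] -/
private theorem padicNorm_intCast_eq_one_of_not_dvd_aux {p : ℕ} [Fact p.Prime] {z : ℤ}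
    (h : ¬ (p : ℤ) ∣ z) : ‖(z : ℚ_[p])‖ = 1 :=
  le_antisymm (Padic.norm_int_le_one z)
    (not_lt.mp fun hlt ↦ h (Padic.norm_intCast_lt_one_iff.mp hlt))

/-- **The Néron ratio at a lattice-optimal member is a `2`-adic unit (Abbes–Ullmo BY NAME).** Let `W₀/ℚ` be
globally minimal with GOOD reduction at `2` and `D₀` a modular parametrisation datum of `W₀` (any level `N₀`) that
is lattice-optimal (`Λ_{W₀} = c₀·Λ_f`). Then for EVERY newform `f` of `W₀` (any level `N`) and every `ϖ ∈ ℚ` with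
`ϖ·Ω_{W₀} = Ω⁺_f`: `ord₂ ϖ = 0`. Proof: `N₀ = N` (`IsNewformOf.level_eq_level`), `D₀.f = f` (`IsNewformOf.unique`),
`Ω_{W₀} = |c₀|·Ω⁺_f` (`realPeriodRat_eq_abs_mul_plusPeriod_of_latticeEq`), `2 ∤ c₀` (Abbes–Ullmo at the good prime
`2`: `2 ∤ N₀` by `not_dvd_level_of_hasGoodReductionAtPrime`). No hypothesis on `E[2]`.
[cite: AbbesUllmo1996, Thm. A] [cite: EdixhovenManin1991, §1] [cite: AtkinLehner1970, Thm. 4] -/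
theorem padicValRat_two_neronRatio_eq_zero_of_latticeOptimal_of_abbesUllmo
    (hAU : abbesUllmo_not_dvd_maninConstant_of_not_dvd_level) (W₀ : WeierstrassCurve ℚ)
    [W₀.IsElliptic] [W₀.IsGloballyMinimal] (hgood : W₀.HasGoodReductionAtPrime 2)
    {N₀ : ℕ} [NeZero N₀] (D₀ : ModularParametrizationData W₀ N₀)
    (hopt : ∀ z ∈ D₀.L.lattice, ∃ w ∈ periodLattice D₀.f, z = D₀.c * w)
    {N : ℕ} [NeZero N] (f : CuspForm (Gamma0 N) 2) (hf : IsNewformOf W₀ f) (ϖ : ℚ)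
    (hϖ : (ϖ : ℝ) * W₀.realPeriodRat = plusPeriod f) : padicValRat 2 ϖ = 0 := by
  have hN : N₀ = N := D₀.isNewformOf.level_eq_level hf
  subst hN
  have hff : D₀.f = f := D₀.isNewformOf.unique hf
  have h2N : ¬ 2 ∣ N₀ := not_dvd_level_of_hasGoodReductionAtPrime hgood hf
  have hc : ¬ (2 : ℤ) ∣ D₀.maninConstant := hAU W₀ D₀ hopt 2 Nat.prime_two h2N
  have hc' : ¬ ((2 : ℕ) : ℤ) ∣ |D₀.c| := fun h ↦ hc ((dvd_abs _ _).mp h)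
  have hm : W₀.realPeriodRat = |(D₀.c : ℝ)| * plusPeriod f := by
    rw [← hff]; exact D₀.realPeriodRat_eq_abs_mul_plusPeriod_of_latticeEq hopt
  have hu : ‖(((|D₀.c| : ℤ) : ℚ) : ℚ_[2])‖ = 1 := by
    rw [Rat.cast_intCast]; exact padicNorm_intCast_eq_one_of_not_dvd_aux hc'
  refine Rank1Residual.padicValRat_periodRatio_eq_zero_of_eq_unit_mul W₀ 2 f hu ?_ ϖ hϖ
  rw [hm, Rat.cast_intCast, Int.cast_abs]

/-- **Clause (b) of B7′ at a lattice-optimal member, from Abbes–Ullmo BY NAME.** For `W₀/ℚ` globally minimal, good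
ORDINARY at `2`, with a lattice-optimal datum `D₀` (`Λ_{W₀} = c₀·Λ_f`): for every newform `f` of `W₀` (any level)
and every `ϖ` with `ϖ·Ω_{W₀} = Ω⁺_f` there is `L₀ ∈ Λ = ℤ₂⟦T⟧` with `ι L₀ = ϖ·L₂(f, α)` — `ord₂ ϖ = 0`
(`padicValRat_two_neronRatio_eq_zero_of_latticeOptimal_of_abbesUllmo`) and INT2-AUTO
(`X5.O1.exists_integral_mul_padicLFunction_two_of_padicValRat_nonneg`). Valid for EVERY image of `ρ̄_{W₀,2}`.
[cite: AbbesUllmo1996, Thm. A] [cite: MazurTateTeitelbaum1986Invent, §I.12] -/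
theorem hint_two_of_latticeOptimal_of_abbesUllmo
    (hAU : abbesUllmo_not_dvd_maninConstant_of_not_dvd_level) (W₀ : WeierstrassCurve ℚ)
    [W₀.IsElliptic] [W₀.IsGloballyMinimal] (hgo : GoodOrd W₀ 2)
    {N₀ : ℕ} [NeZero N₀] (D₀ : ModularParametrizationData W₀ N₀)
    (hopt : ∀ z ∈ D₀.L.lattice, ∃ w ∈ periodLattice D₀.f, z = D₀.c * w)
    {N : ℕ} [NeZero N] (f : CuspForm (Gamma0 N) 2) (hf : IsNewformOf W₀ f) (ϖ : ℚ)
    (hϖ : (ϖ : ℝ) * W₀.realPeriodRat = plusPeriod f) :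
    ∃ L₀ : IwasawaAlgebra 2, iwasawaToPowerSeries 2 L₀ =
      PowerSeries.C (ϖ : ℚ_[2]) * padicLFunction f (unitRoot W₀ 2 : ℚ_[2]) :=
  O1.exists_integral_mul_padicLFunction_two_of_padicValRat_nonneg W₀ ⟨hgo.1, hgo.2⟩ hf
    (padicValRat_two_neronRatio_eq_zero_of_latticeOptimal_of_abbesUllmo hAU W₀ hgo.1 D₀ hopt f hf ϖ hϖ).ge

/-! ## §2 B7′'s conclusion at `W` from its optimal member -/

/-- **B7′'s conclusion at `W` from a lattice-optimal member of its class.** Let `W` be globally minimal, good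
ordinary at `2`, and `W₀ ∼ W` an isogenous globally minimal member with a lattice-optimal datum `D₀`. If `W₀` carries
«`X5.O1.KatoMuPartAtTwo W₀` OR a rational `2`-torsion point `(x, y)` that is ramified-at-`2` XOR odd», then the BODY of
`KatoMuPartOff514AtOptimalMemberOfNotSurjectiveTwo` holds at `W` with witness `W′ := W₀`: clause (b) is
`hint_two_of_latticeOptimal_of_abbesUllmo` (good ordinary passes along the isogeny, `goodOrd_two_of_isIsogenous`).
[cite: AbbesUllmo1996, Thm. A] [cite: GreenbergLNM1716, Prop. 5.14 (shape of the datum only)] -/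
theorem katoMuPartOff514Conclusion_of_latticeOptimal
    (hAU : abbesUllmo_not_dvd_maninConstant_of_not_dvd_level) (W : WeierstrassCurve ℚ) [W.IsElliptic]
    [W.IsGloballyMinimal] (hgo : GoodOrd W 2) (W₀ : WeierstrassCurve ℚ) [W₀.IsElliptic] [W₀.IsGloballyMinimal]
    (hiso : WeierstrassCurve.IsIsogenous W W₀) {N₀ : ℕ} [NeZero N₀] (D₀ : ModularParametrizationData W₀ N₀)
    (hopt : ∀ z ∈ D₀.L.lattice, ∃ w ∈ periodLattice D₀.f, z = D₀.c * w)
    (h : O1.KatoMuPartAtTwo W₀ ∨ ∃ x y : ℚ, W₀.toAffine.Equation x y ∧ 2 * y + W₀.a₁ * x + W₀.a₃ = 0 ∧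
      ((TwoTorsionRamifiedAtTwo x ∧ ¬ TwoTorsionOdd W₀ x) ∨ (TwoTorsionOdd W₀ x ∧ ¬ TwoTorsionRamifiedAtTwo x))) :
    ∃ (W' : WeierstrassCurve ℚ) (_ : W'.IsElliptic) (_ : W'.IsGloballyMinimal),
      WeierstrassCurve.IsIsogenous W W' ∧
      (O1.KatoMuPartAtTwo W' ∨ ∃ x y : ℚ, W'.toAffine.Equation x y ∧ 2 * y + W'.a₁ * x + W'.a₃ = 0 ∧
        ((TwoTorsionRamifiedAtTwo x ∧ ¬ TwoTorsionOdd W' x) ∨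
          (TwoTorsionOdd W' x ∧ ¬ TwoTorsionRamifiedAtTwo x))) ∧
      ∀ [NeZero (W'.conductorNorm ℤ)] (f : CuspForm (Gamma0 (W'.conductorNorm ℤ)) 2),
        IsNewformOf W' f → ∀ ϖ : ℚ, (ϖ : ℝ) * W'.realPeriodRat = plusPeriod f →
          ∃ L₀ : IwasawaAlgebra 2, iwasawaToPowerSeries 2 L₀ =
            PowerSeries.C (ϖ : ℚ_[2]) * padicLFunction f (unitRoot W' 2 : ℚ_[2]) :=
  ⟨W₀, ‹_›, ‹_›, hiso, h, fun f hf ϖ hϖ ↦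
    hint_two_of_latticeOptimal_of_abbesUllmo hAU W₀ (goodOrd_two_of_isIsogenous W hiso hgo) D₀ hopt f hf ϖ hϖ⟩

/-- **The PRINT-COMPLETE case of B7′: a Prop-5.14 point ON THE OPTIMAL CURVE.** If an isogenous lattice-optimal
member `W₀` of `W` (good ordinary at `2`) carries a rational `2`-torsion point that is ramified-at-`2` XOR odd, the
body of B7′ holds at `W` modulo Abbes–Ullmo by name — no memo content. This is the per-class census door («does the
`X₀(N)`-optimal curve carry the 5.14 point?»; a kit count over the 665 `E[2]`-reducible good-ordinary non-CM classes
with odd `N ≤ 3000` is NOT run here). [cite: AbbesUllmo1996, Thm. A] [cite: GreenbergLNM1716, Prop. 5.14 (datum shape)] -/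
theorem katoMuPartOff514Conclusion_of_latticeOptimal_prop514Point
    (hAU : abbesUllmo_not_dvd_maninConstant_of_not_dvd_level) (W : WeierstrassCurve ℚ) [W.IsElliptic]
    [W.IsGloballyMinimal] (hgo : GoodOrd W 2) (W₀ : WeierstrassCurve ℚ) [W₀.IsElliptic] [W₀.IsGloballyMinimal]
    (hiso : WeierstrassCurve.IsIsogenous W W₀) {N₀ : ℕ} [NeZero N₀] (D₀ : ModularParametrizationData W₀ N₀)
    (hopt : ∀ z ∈ D₀.L.lattice, ∃ w ∈ periodLattice D₀.f, z = D₀.c * w)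
    {x y : ℚ} (hP : W₀.toAffine.Equation x y) (h2 : 2 * y + W₀.a₁ * x + W₀.a₃ = 0)
    (hΦ : (TwoTorsionRamifiedAtTwo x ∧ ¬ TwoTorsionOdd W₀ x) ∨ (TwoTorsionOdd W₀ x ∧ ¬ TwoTorsionRamifiedAtTwo x)) :
    ∃ (W' : WeierstrassCurve ℚ) (_ : W'.IsElliptic) (_ : W'.IsGloballyMinimal),
      WeierstrassCurve.IsIsogenous W W' ∧
      (O1.KatoMuPartAtTwo W' ∨ ∃ x y : ℚ, W'.toAffine.Equation x y ∧ 2 * y + W'.a₁ * x + W'.a₃ = 0 ∧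
        ((TwoTorsionRamifiedAtTwo x ∧ ¬ TwoTorsionOdd W' x) ∨
          (TwoTorsionOdd W' x ∧ ¬ TwoTorsionRamifiedAtTwo x))) ∧
      ∀ [NeZero (W'.conductorNorm ℤ)] (f : CuspForm (Gamma0 (W'.conductorNorm ℤ)) 2),
        IsNewformOf W' f → ∀ ϖ : ℚ, (ϖ : ℝ) * W'.realPeriodRat = plusPeriod f →
          ∃ L₀ : IwasawaAlgebra 2, iwasawaToPowerSeries 2 L₀ =
            PowerSeries.C (ϖ : ℚ_[2]) * padicLFunction f (unitRoot W' 2 : ℚ_[2]) :=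
  katoMuPartOff514Conclusion_of_latticeOptimal hAU W hgo W₀ hiso D₀ hopt (Or.inr ⟨x, y, hP, h2, hΦ⟩)

/-! ## §3 B7′ BY NAME with the member pinned to the optimal curve -/

/-- **Every class has a lattice-optimal globally minimal member (modularity + Edixhoven, tree theorems).** For a
globally minimal elliptic `W` and the modularity input `nonempty_modularParametrizationData` (a datum at level `N_W`;
the route's PUB first conjunct): there is an isogenous globally minimal `W₀` with a lattice-optimal datum at level
`N_W` (`ModularParametrizationData.exists_optimalDatum_of_edixhoven`, Edixhoven's Prop. 2 discharged by
`edixhoven_int_of_neronLattice_eq_smul_periodLattice_holds`). [cite: EdixhovenManin1991, Prop. 2] -/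
theorem exists_isIsogenous_latticeOptimal (hMod : nonempty_modularParametrizationData) (W : WeierstrassCurve ℚ)
    [W.IsElliptic] [W.IsGloballyMinimal] :
    ∃ (W₀ : WeierstrassCurve ℚ) (_ : W₀.IsElliptic) (_ : W₀.IsGloballyMinimal) (N₀ : ℕ) (_ : NeZero N₀)
      (D₀ : ModularParametrizationData W₀ N₀), WeierstrassCurve.IsIsogenous W W₀ ∧
        ∀ z ∈ D₀.L.lattice, ∃ w ∈ periodLattice D₀.f, z = D₀.c * w := by
  haveI : NeZero (W.conductorNorm ℤ) := ⟨(W.conductorNorm_pos_holds).ne'⟩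
  obtain ⟨D⟩ := hMod W
  obtain ⟨W₀, hW₀, hW₀', D₀, -, hiso, hopt, -⟩ :=
    D.exists_optimalDatum_of_edixhoven
      (fun hf' hL' q hq hq' ↦ edixhoven_int_of_neronLattice_eq_smul_periodLattice_holds hf' hL' q hq hq')
  exact ⟨W₀, hW₀, hW₀', _, inferInstance, D₀, hiso, hopt⟩

/-- **B7′ BY NAME ⟸ Abbes–Ullmo + modularity + «μ-part OR Prop-5.14 point AT THE OPTIMAL MEMBER».** The one
member-free binder `hOpt` reads: for every non-CM globally minimal `W`, good ordinary at `2`, with `ρ̄_{W,2}` NOT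
onto, and every isogenous globally minimal lattice-optimal `W₀` (datum `D₀` with `Λ_{W₀} = c₀·Λ_f`):
`X5.O1.KatoMuPartAtTwo W₀` OR `W₀` carries a ramified-XOR-odd rational `2`-torsion point. Then
`KatoMuPartOff514AtOptimalMemberOfNotSurjectiveTwo` (child B7′ of crux `OrdKatoHalfAtTwoIso`) holds: the witness is
the optimal member (`exists_isIsogenous_latticeOptimal`) and clause (b) is print there
(`hint_two_of_latticeOptimal_of_abbesUllmo`). Conditional; nothing closed; `hOpt`'s left disjunct off the locus
«the optimal curve carries the 5.14 point» is Greenberg's Conj. 1.11-type content at `2` (nothing asserted).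
[cite: AbbesUllmo1996, Thm. A] [cite: EdixhovenManin1991, Prop. 2] [cite: GreenbergLNM1716, Prop. 5.14 and p. 170 (shape only)] -/
theorem katoMuPartOff514_of_optimalMember (hAU : abbesUllmo_not_dvd_maninConstant_of_not_dvd_level)
    (hMod : nonempty_modularParametrizationData)
    (hOpt : ∀ (W : WeierstrassCurve ℚ) [W.IsElliptic] [W.IsGloballyMinimal],
      ¬ W.HasCM → GoodOrd W 2 → ¬ W.HasSurjectiveModNGaloisRep 2 →
      ∀ (W₀ : WeierstrassCurve ℚ) [W₀.IsElliptic] [W₀.IsGloballyMinimal] {N₀ : ℕ} [NeZero N₀]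
        (D₀ : ModularParametrizationData W₀ N₀), WeierstrassCurve.IsIsogenous W W₀ →
        (∀ z ∈ D₀.L.lattice, ∃ w ∈ periodLattice D₀.f, z = D₀.c * w) →
        O1.KatoMuPartAtTwo W₀ ∨ ∃ x y : ℚ, W₀.toAffine.Equation x y ∧ 2 * y + W₀.a₁ * x + W₀.a₃ = 0 ∧
          ((TwoTorsionRamifiedAtTwo x ∧ ¬ TwoTorsionOdd W₀ x) ∨
            (TwoTorsionOdd W₀ x ∧ ¬ TwoTorsionRamifiedAtTwo x))) :
    KatoMuPartOff514AtOptimalMemberOfNotSurjectiveTwo := by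
  intro W _ _ hcm hgo him
  obtain ⟨W₀, _, _, N₀, _, D₀, hiso, hopt⟩ := exists_isIsogenous_latticeOptimal hMod W
  exact katoMuPartOff514Conclusion_of_latticeOptimal hAU W hgo W₀ hiso D₀ hopt
    (hOpt W hcm hgo him W₀ D₀ hiso hopt)

/-- **The reducible part of B7′ BY NAME, with the member pinned to the optimal curve**: the same door onto
`KatoMuPartOff514ReducibleTwo` (p680193), the binder now restricted to `E[2]`-REDUCIBLE `W`. Conditional; nothing
closed. [cite: AbbesUllmo1996, Thm. A] [cite: EdixhovenManin1991, Prop. 2] [cite: GreenbergLNM1716, Prop. 5.14 and p. 170 (shape only)] -/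
theorem katoMuPartOff514Reducible_of_optimalMember (hAU : abbesUllmo_not_dvd_maninConstant_of_not_dvd_level)
    (hMod : nonempty_modularParametrizationData)
    (hOptRed : ∀ (W : WeierstrassCurve ℚ) [W.IsElliptic] [W.IsGloballyMinimal],
      ¬ W.HasCM → GoodOrd W 2 → ¬ W.HasIrreducibleModPGaloisRep 2 →
      ∀ (W₀ : WeierstrassCurve ℚ) [W₀.IsElliptic] [W₀.IsGloballyMinimal] {N₀ : ℕ} [NeZero N₀]
        (D₀ : ModularParametrizationData W₀ N₀), WeierstrassCurve.IsIsogenous W W₀ →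
        (∀ z ∈ D₀.L.lattice, ∃ w ∈ periodLattice D₀.f, z = D₀.c * w) →
        O1.KatoMuPartAtTwo W₀ ∨ ∃ x y : ℚ, W₀.toAffine.Equation x y ∧ 2 * y + W₀.a₁ * x + W₀.a₃ = 0 ∧
          ((TwoTorsionRamifiedAtTwo x ∧ ¬ TwoTorsionOdd W₀ x) ∨
            (TwoTorsionOdd W₀ x ∧ ¬ TwoTorsionRamifiedAtTwo x))) :
    KatoMuPartOff514ReducibleTwo := by
  intro W _ _ hcm hgo hred
  obtain ⟨W₀, _, _, N₀, _, D₀, hiso, hopt⟩ := exists_isIsogenous_latticeOptimal hMod W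
  exact katoMuPartOff514Conclusion_of_latticeOptimal hAU W hgo W₀ hiso D₀ hopt
    (hOptRed W hcm hgo hred W₀ D₀ hiso hopt)

/-! ## §4 The K4 child BY NAME (route decl `OrdKatoMuPartOptimalAtTwo`, stmt-BirchSwinnertonDyer-23921) -/

/-- **The route's child `OrdKatoMuPartOptimalAtTwo` (stmt-BirchSwinnertonDyer-23921; its text is VERBATIM the body of
`KatoMuPartOff514AtOptimalMemberOfNotSurjectiveTwo`, `Iff.rfl`) from Abbes–Ullmo + modularity + the optimal-member
binder `hOpt`** — one application of `katoMuPartOff514_of_optimalMember`. CONDITIONAL; the item is NOT closed by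
this (the binder `hOpt` is memo-tier off the «optimal curve carries the 5.14 point» locus); nothing asserted.
[cite: AbbesUllmo1996, Thm. A] [cite: EdixhovenManin1991, Prop. 2] [cite: GreenbergLNM1716, Prop. 5.14 and p. 170 (shape only)] -/
theorem ordKatoMuPartOptimalAtTwo_of_optimalMember (hAU : abbesUllmo_not_dvd_maninConstant_of_not_dvd_level)
    (hMod : nonempty_modularParametrizationData)
    (hOpt : ∀ (W : WeierstrassCurve ℚ) [W.IsElliptic] [W.IsGloballyMinimal],
      ¬ W.HasCM → GoodOrd W 2 → ¬ W.HasSurjectiveModNGaloisRep 2 →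
      ∀ (W₀ : WeierstrassCurve ℚ) [W₀.IsElliptic] [W₀.IsGloballyMinimal] {N₀ : ℕ} [NeZero N₀]
        (D₀ : ModularParametrizationData W₀ N₀), WeierstrassCurve.IsIsogenous W W₀ →
        (∀ z ∈ D₀.L.lattice, ∃ w ∈ periodLattice D₀.f, z = D₀.c * w) →
        O1.KatoMuPartAtTwo W₀ ∨ ∃ x y : ℚ, W₀.toAffine.Equation x y ∧ 2 * y + W₀.a₁ * x + W₀.a₃ = 0 ∧
          ((TwoTorsionRamifiedAtTwo x ∧ ¬ TwoTorsionOdd W₀ x) ∨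
            (TwoTorsionOdd W₀ x ∧ ¬ TwoTorsionRamifiedAtTwo x))) :
    OrdKatoMuPartOptimalAtTwo :=
  katoMuPartOff514_of_optimalMember hAU hMod hOpt

end Summit.BirchSwinnertonDyer.BirchSwinnertonDyer.Theorems.SteinbergFibreAtTwo

end
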